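import Mathlib
import Literature.MathematicalPhysics.QuantumLattice.YangMillsClassical
import HarnessLib

/-!
# Zero-mode action floor — duality bookkeeping for the curvature (lead c7, line
`zero-mode-floor-dilute-gas` of crux `NestedDissectionSea.EarlyCrosserLaw`, stmt-QuantumFields-13995)

Helpers for the registered stub `stub_floorAssembly`: with `F_μν ∈ M₃(ℂ)` and Frobenius norms,
the parallelogram identity `Σ_a‖F⁻_a‖² + Σ_a‖F⁺_a‖² = 2Σ_{μ<ν}‖F_μν‖²` for the duality combinations
`F⁻ = (F₀₁−F₂₃, F₀₂+F₁₃, F₀₃−F₁₂)`, `F⁺ = (F₀₁+F₂₃, F₀₂−F₁₃, F₀₃+F₁₂)`, the charge identity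
`Σ‖F⁺‖² − Σ‖F⁻‖² = −4 Re tr(F₀₁F₂₃ − F₀₂F₁₃ + F₀₃F₁₂)` for anti-Hermitian `F_μν`, and the
coordinate-frame Yang–Mills density of the tree written out as the six-term sum.
-/

noncomputable section

open scoped BigOperators Matrix Matrix.Norms.Frobenius
open Literature.MathematicalPhysics.QuantumLattice

namespace Summit.QuantumFields.QCD.Cruxes.EarlyCrosserLaw.ZeroModeFloorDiluteGas

/-- Parallelogram law for the Frobenius norm on complex matrices: `‖X−Y‖² + ‖X+Y‖² = 2(‖X‖² + ‖Y‖²)`. -/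
theorem frobenius_norm_sq_sub_add_norm_sq_add {m n : Type*} [Fintype m] [Fintype n]
    (X Y : Matrix m n ℂ) : ‖X - Y‖ ^ 2 + ‖X + Y‖ ^ 2 = 2 * (‖X‖ ^ 2 + ‖Y‖ ^ 2) := by
  simp only [Matrix.frobenius_norm_sq_eq_re_trace, Matrix.conjTranspose_add, Matrix.conjTranspose_sub,
    Matrix.add_mul, Matrix.mul_add, Matrix.sub_mul, Matrix.mul_sub, Matrix.trace_add, Matrix.trace_sub,
    map_add, map_sub]
  ring

/-- For anti-Hermitian square matrices: `‖X+Y‖² − ‖X−Y‖² = −4 Re tr(XY)` (Frobenius norm). -/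
theorem frobenius_norm_sq_add_sub_norm_sq_sub_of_conjTranspose {m : Type*} [Fintype m]
    (X Y : Matrix m m ℂ) (hX : Xᴴ = -X) (hY : Yᴴ = -Y) :
    ‖X + Y‖ ^ 2 - ‖X - Y‖ ^ 2 = -4 * ((X * Y).trace).re := by
  rw [Matrix.frobenius_norm_sq_eq_re_trace, Matrix.frobenius_norm_sq_eq_re_trace, Matrix.conjTranspose_add,
    Matrix.conjTranspose_sub, hX, hY]
  simp only [Matrix.add_mul, Matrix.mul_add, Matrix.sub_mul, Matrix.mul_sub, Matrix.neg_mul,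
    Matrix.trace_add, Matrix.trace_sub, Matrix.trace_neg, map_add, map_sub, map_neg,
    Matrix.trace_mul_comm Y X, RCLike.re_to_complex]
  ring

/-- **Duality, parallelogram half.**  `Σ_a‖F⁻_a‖² + Σ_a‖F⁺_a‖² = 2 Σ_{μ<ν} ‖F_μν‖²`. -/
theorem duality_norm_sq_add (F : Fin 4 → Fin 4 → Matrix (Fin 3) (Fin 3) ℂ) :
    (‖F 0 1 - F 2 3‖ ^ 2 + ‖F 0 2 + F 1 3‖ ^ 2 + ‖F 0 3 - F 1 2‖ ^ 2)
      + (‖F 0 1 + F 2 3‖ ^ 2 + ‖F 0 2 - F 1 3‖ ^ 2 + ‖F 0 3 + F 1 2‖ ^ 2)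
    = 2 * (‖F 0 1‖ ^ 2 + ‖F 0 2‖ ^ 2 + ‖F 0 3‖ ^ 2 + ‖F 1 2‖ ^ 2 + ‖F 1 3‖ ^ 2 + ‖F 2 3‖ ^ 2) := by
  have h1 := frobenius_norm_sq_sub_add_norm_sq_add (F 0 1) (F 2 3)
  have h2 := frobenius_norm_sq_sub_add_norm_sq_add (F 0 2) (F 1 3)
  have h3 := frobenius_norm_sq_sub_add_norm_sq_add (F 0 3) (F 1 2)
  linarith

/-- **Duality, charge half.**  For anti-Hermitian `F_μν`:
`Σ_a‖F⁺_a‖² − Σ_a‖F⁻_a‖² = −4 Re tr(F₀₁F₂₃ − F₀₂F₁₃ + F₀₃F₁₂)` (the Chern–Weil integrand). -/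
theorem duality_norm_sq_sub (F : Fin 4 → Fin 4 → Matrix (Fin 3) (Fin 3) ℂ)
    (hF : ∀ μ ν, (F μ ν)ᴴ = -(F μ ν)) :
    (‖F 0 1 + F 2 3‖ ^ 2 + ‖F 0 2 - F 1 3‖ ^ 2 + ‖F 0 3 + F 1 2‖ ^ 2)
      - (‖F 0 1 - F 2 3‖ ^ 2 + ‖F 0 2 + F 1 3‖ ^ 2 + ‖F 0 3 - F 1 2‖ ^ 2)
    = -4 * ((F 0 1 * F 2 3).trace - (F 0 2 * F 1 3).trace + (F 0 3 * F 1 2).trace).re := by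
  have h1 := frobenius_norm_sq_add_sub_norm_sq_sub_of_conjTranspose (F 0 1) (F 2 3) (hF 0 1) (hF 2 3)
  have h2 := frobenius_norm_sq_add_sub_norm_sq_sub_of_conjTranspose (F 0 2) (F 1 3) (hF 0 2) (hF 1 3)
  have h3 := frobenius_norm_sq_add_sub_norm_sq_sub_of_conjTranspose (F 0 3) (F 1 2) (hF 0 3) (hF 1 2)
  simp only [Complex.add_re, Complex.sub_re]
  linarith

/-- The six-pair sum over `μ < ν` in `Fin 4`, written out (real version). -/
theorem sum_pairs_lt_real (f : Fin 4 → Fin 4 → ℝ) :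
    (∑ μ : Fin 4, ∑ ν : Fin 4, if μ < ν then f μ ν else 0) =
      f 0 1 + f 0 2 + f 0 3 + f 1 2 + f 1 3 + f 2 3 := by
  simp only [Fin.sum_univ_four, Fin.isValue]
  norm_num [Fin.lt_def]
  ring

/-- The coordinate-frame Yang–Mills density of the tree on `ℝ⁴`, written out:
`ymDensityOfBasis (basisFun) A x = Σ_{μ<ν} ‖F_A(x)(e_μ, e_ν)‖²` with `e_μ = EuclideanSpace.single μ 1`. -/
theorem ymDensityOfBasis_basisFun_eq (A : Connection (EuclideanSpace ℝ (Fin 4)) (Matrix (Fin 3) (Fin 3) ℂ))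
    (x : EuclideanSpace ℝ (Fin 4)) :
    ymDensityOfBasis (EuclideanSpace.basisFun (Fin 4) ℝ) A x =
      ‖curvature A x (EuclideanSpace.single 0 (1 : ℝ)) (EuclideanSpace.single 1 (1 : ℝ))‖ ^ 2
      + ‖curvature A x (EuclideanSpace.single 0 (1 : ℝ)) (EuclideanSpace.single 2 (1 : ℝ))‖ ^ 2
      + ‖curvature A x (EuclideanSpace.single 0 (1 : ℝ)) (EuclideanSpace.single 3 (1 : ℝ))‖ ^ 2
      + ‖curvature A x (EuclideanSpace.single 1 (1 : ℝ)) (EuclideanSpace.single 2 (1 : ℝ))‖ ^ 2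
      + ‖curvature A x (EuclideanSpace.single 1 (1 : ℝ)) (EuclideanSpace.single 3 (1 : ℝ))‖ ^ 2
      + ‖curvature A x (EuclideanSpace.single 2 (1 : ℝ)) (EuclideanSpace.single 3 (1 : ℝ))‖ ^ 2 := by
  unfold ymDensityOfBasis
  simp only [EuclideanSpace.basisFun_apply]
  exact sum_pairs_lt_real _

end Summit.QuantumFields.QCD.Cruxes.EarlyCrosserLaw.ZeroModeFloorDiluteGas

end
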